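import Summits.QuantumFields.BalabanUV.T4Continuum.Support.CellTaylorPlanting

/-!
# Beta / GAN24 / MultilinearProlongation — THE MULTILINEAR (tensor-product) PROLONGATION of a coarse scalar field to the `R`-times finer torus
# and ITS EXACT ENERGY INEQUALITY `Σ_{x′} |P u(x′+e′_μ) − P u(x′)|² ≤ R^{d−2}·Σ_x |u(x+e_μ) − u(x)|²`: step S2 («prolongation does not raise the
# Wilson energy») of candidate route R1 of `HOME/beta/ROUTES-GAN24.md` v1, scalar prototype, every `d`, every torus, hypothesis-free
# (binder row G-an2-4 ∕ (CONV-C); road P2 seat gan24-p2 gen 28; NOT IN PRINT — our proof attempt)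

HONEST FRAMING (page 1 of everything the β sub-cell writes): discharging `BetaPertH` makes Bałaban's UV stability UNCONDITIONAL — a
real constructive-QFT result; it is NOT the continuum limit and NOT the Clay problem.  HONEST DEPENDENCY (cell reorg 2026-08-19, verbatim):
«continuum YM on T⁴ ⇐ BetaPertH ∧ nine spine estimates (0/9 proved); BetaPertH ⇐ (D1) ∧ (D4) ∧ CAP+tail; G-an2-4 gates asym, D1 and NE2/3/4.»
HONEST LABEL: «not in print; our proof attempt»; 0 wall binders instantiated; NEVER «G-an2-4 closed».

ABSOLUTE RULE (cell charter, verbatim): "No internally-minted statement may enter as a cited fact. Every hypothesis is either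
kernel-proved in this package or a verbatim quotation of a PUBLISHED theorem with page reference. The manuscript(s) under audit are
NOT citable for their own disputed steps — they are the thing under adjudication; programme-internal (2001/route/tribunal) claims
are never citable."  Nothing is cited; [folklore] finite lattice calculus on the two-level tori of NE2's `BalabanAveragedTowerModes` (`par`, `rem`),
`B5G183RateTorus(W)` (`cpt`, `off`), NE2 leaf-05's `CellTaylorPlanting` (`rem` under unit steps, the tile sum) and `BlockPairingGeometry.par_add_unitVec`
BY NAME; the algebraic core follows the pattern of NE3 leaf-10's `SmoothRefineInterp` (there on `ℤ^d`); no `def … : Prop`.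

## THE OBJECTS (coarse torus `T = Tor (fine N M)`, fine torus `T′ = Tor (fine (R·N) M)`, King's cells `par : T′ → T`, offsets `rem : T′ → [0,R)^d`)
* `vtx T = Σ_{ν∈T} e_ν` (vertex vector of a direction set), `vwt s T w = Π_{ν∈T} w_ν · Π_{ν∈s∖T} (1 − w_ν)` (tensor weights),
  `icore s u z w = Σ_{T⊆s} vwt s T w · u(z + vtx T)` (multilinear interpolation of `u` in the directions `s` around `z` with weights `w`);
* `twR x ν = rem(x)_ν / R` and **`Pml u x := icore univ u (par x) (twR x)`** — the multilinear prolongation.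
## WHAT IS PROVED (0 sorry; every `d`, `N, R ≥ 1`, torus `M`)
* §1 `icore_insert` (the tensor recursion), `sum_vwt` (`Σ_T vwt = 1`), `vwt_nonneg`, **`norm_icore_sq_le`** (convexity: `|icore|² ≤ Σ_T vwt·|u(z+vtx T)|²`),
  linearity and shift;
* §2 **`Pml_step`**: `Pml u (x + e′_μ) − Pml u x = R⁻¹ · icore (univ ∖ {μ}) (∇_μ u) (par x) (twR x)` — ONE formula for the in-cell steps and the
  cell-crossing step (piecewise multilinear functions are continuous);
* §3 **`sum_norm_sq_Pml_step_le`**: `Σ_{x′} |Pml u (x′+e′_μ) − Pml u x′|² ≤ (R^d/R²)·Σ_x |u(x+e_μ) − u x|²` — the tensor weights sum to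
  `R·((R−1)/2)^{|T|}((R+1)/2)^{d−1−|T|}` over a cell and `Σ_T` of these is `R^d`; translation invariance of the torus sum; and the all-directions
  form **`energy_Pml_le`**: `Σ_μ Σ_{x′} |∇′_μ Pml u|² ≤ (R^d/R²)·Σ_μ Σ_x |∇_μ u|²` — with the Wilson normalisation `S_η = ½η^{d−2}Σ|∇u|²` this is
  `S_{η/R}(Pml u) ≤ S_η(u)`: hypothesis (PROL) of `GAN24/MonotoneSqueeze` for the scalar prototype.
WHAT THIS IS NOT: the 1-form (cubical cochain) prolongation `dP₁ = P₂d` (same mechanism per component, not typed here; numerically exact in (P-R1c));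
the row defect `Q_{R·N}·Pml − Q_N` (R1-S3); nothing about minimisers; NOT (CONV-C), NOT D1, NOT BetaPertH, NOT continuum, NOT Clay.
-/

noncomputable section

namespace Summit.QuantumFields.BalabanUV.Beta.GAN24.MultilinearProlongation

open Finset
open scoped BigOperators
open Literature.MathematicalPhysics.QuantumFieldTheory.Balaban1983to89.B5Prop11Plancherel (Tor fine unitVec)
open Literature.MathematicalPhysics.QuantumFieldTheory.Balaban1983to89.B5G183RateTorus (cpt)
open Literature.MathematicalPhysics.QuantumFieldTheory.Balaban1983to89.B5G183RateTorusW (off)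
open Summit.QuantumFields.BalabanUV.T4Continuum.BalabanAveragedTowerModes (par rem par_cpt_add_off rem_cpt_add_off)
open Summit.QuantumFields.BalabanUV.T4Continuum.BlockPairingGeometry (par_add_unitVec)
open Summit.QuantumFields.BalabanUV.T4Continuum.CellTaylorPlanting (rem_add_unitVec_of_ne val_rem_of_face val_rem_add_unitVec_of_face
  val_rem_add_unitVec_of_not_face sum_fine_eq_sum_tile_real)

variable {d : ℕ}

/-! ## §1 The multilinear core on a torus -/

section Core

variable (Nc : Fin d → ℕ)

/-- the vertex vector of a direction set: `vtx T = Σ_{ν∈T} e_ν`. [folklore] -/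
def vtx (T : Finset (Fin d)) : Tor Nc := ∑ ν ∈ T, unitVec Nc ν

/-- `vtx (insert μ T) = e_μ + vtx T` for `μ ∉ T`. [folklore] -/
theorem vtx_insert {μ : Fin d} {T : Finset (Fin d)} (h : μ ∉ T) : vtx Nc (insert μ T) = unitVec Nc μ + vtx Nc T := by
  rw [vtx, vtx, sum_insert h]

/-- the tensor weight of the vertex set `T` among the directions `s`: `Π_{ν∈T} w_ν · Π_{ν∈s∖T} (1 − w_ν)`. [folklore] -/
def vwt (s T : Finset (Fin d)) (w : Fin d → ℝ) : ℝ := (∏ ν ∈ T, w ν) * ∏ ν ∈ s \ T, (1 - w ν)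

/-- **`Σ_{T⊆s} vwt s T w = 1`** (expand `Π_{ν∈s} (w_ν + (1 − w_ν))`). [folklore] -/
theorem sum_vwt (s : Finset (Fin d)) (w : Fin d → ℝ) : ∑ T ∈ s.powerset, vwt s T w = 1 := by
  have h := Finset.prod_add (fun ν => w ν) (fun ν => 1 - w ν) s
  simp only [add_sub_cancel, prod_const_one] at h
  rw [h]; rfl

/-- `vwt ≥ 0` for weights in `[0,1]` on `s`. [folklore] -/
theorem vwt_nonneg {s : Finset (Fin d)} {w : Fin d → ℝ} (h0 : ∀ ν ∈ s, 0 ≤ w ν) (h1 : ∀ ν ∈ s, w ν ≤ 1) {T : Finset (Fin d)} (hT : T ⊆ s) :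
    0 ≤ vwt s T w :=
  mul_nonneg (prod_nonneg fun ν hν => h0 ν (hT hν)) (prod_nonneg fun ν hν => sub_nonneg.mpr (h1 ν (sdiff_subset hν)))

/-- `vwt` depends only on the weights on `s`. [folklore] -/
theorem vwt_congr {s : Finset (Fin d)} {w w' : Fin d → ℝ} (h : ∀ ν ∈ s, w ν = w' ν) {T : Finset (Fin d)} (hT : T ⊆ s) :
    vwt s T w = vwt s T w' := by
  unfold vwt
  congr 1
  · exact prod_congr rfl fun ν hν => h ν (hT hν)
  · exact prod_congr rfl fun ν hν => by rw [h ν (sdiff_subset hν)]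

/-- **MULTILINEAR INTERPOLATION** of `u` in the directions `s` around the base point `z` with weights `w`:
`icore s u z w = Σ_{T⊆s} vwt s T w · u(z + vtx T)`. [folklore] -/
def icore (s : Finset (Fin d)) (u : Tor Nc → ℂ) (z : Tor Nc) (w : Fin d → ℝ) : ℂ :=
  ∑ T ∈ s.powerset, (vwt s T w : ℂ) * u (z + vtx Nc T)

/-- `icore` depends only on the weights on `s`. [folklore] -/
theorem icore_congr_w (s : Finset (Fin d)) (u : Tor Nc → ℂ) (z : Tor Nc) {w w' : Fin d → ℝ} (h : ∀ ν ∈ s, w ν = w' ν) :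
    icore Nc s u z w = icore Nc s u z w' :=
  sum_congr rfl fun T hT => by rw [vwt_congr h (mem_powerset.mp hT)]

/-- linearity: `icore s (u − v) = icore s u − icore s v`. [folklore] -/
theorem icore_sub (s : Finset (Fin d)) (u v : Tor Nc → ℂ) (z : Tor Nc) (w : Fin d → ℝ) :
    icore Nc s (fun y => u y - v y) z w = icore Nc s u z w - icore Nc s v z w := by
  simp only [icore, mul_sub, sum_sub_distrib]

/-- shift: `icore s u (z + e) w = icore s (u(· + e)) z w`. [folklore] -/
theorem icore_shift (s : Finset (Fin d)) (u : Tor Nc → ℂ) (z e : Tor Nc) (w : Fin d → ℝ) :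
    icore Nc s u (z + e) w = icore Nc s (fun y => u (y + e)) z w :=
  sum_congr rfl fun T _ => by rw [add_right_comm]

/-- **THE TENSOR RECURSION**: for `μ ∉ s`, `icore (insert μ s) u z w = (1 − w_μ)·icore s u z w + w_μ·icore s u (z + e_μ) w`. [folklore] -/
theorem icore_insert {μ : Fin d} {s : Finset (Fin d)} (hμ : μ ∉ s) (u : Tor Nc → ℂ) (z : Tor Nc) (w : Fin d → ℝ) :
    icore Nc (insert μ s) u z w = ((1 - w μ : ℝ) : ℂ) * icore Nc s u z w + (w μ : ℂ) * icore Nc s u (z + unitVec Nc μ) w := by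
  have hdisj : Disjoint s.powerset (s.powerset.image (insert μ)) := by
    rw [disjoint_left]
    intro T hT hT'
    obtain ⟨T₀, _, rfl⟩ := mem_image.mp hT'
    exact hμ (mem_powerset.mp hT (mem_insert_self μ T₀))
  have hinj : Set.InjOn (insert μ) (s.powerset : Set (Finset (Fin d))) := by
    intro T hT T' hT' h
    have hμT : μ ∉ T := fun hh => hμ (mem_powerset.mp hT hh)
    have hμT' : μ ∉ T' := fun hh => hμ (mem_powerset.mp hT' hh)
    rw [← erase_insert hμT, h, erase_insert hμT']
  rw [icore, powerset_insert, sum_union hdisj, sum_image hinj, icore, icore, mul_sum, mul_sum]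
  congr 1
  · refine sum_congr rfl fun T hT => ?_
    have hTs : T ⊆ s := mem_powerset.mp hT
    have hμT : μ ∉ T := fun hh => hμ (hTs hh)
    have e : vwt (insert μ s) T w = (1 - w μ) * vwt s T w := by
      unfold vwt
      rw [insert_sdiff_of_notMem s hμT, prod_insert (fun hh => hμ (sdiff_subset hh))]
      ring
    rw [e]; push_cast; ring
  · refine sum_congr rfl fun T hT => ?_
    have hTs : T ⊆ s := mem_powerset.mp hT
    have hμT : μ ∉ T := fun hh => hμ (hTs hh)
    have e : vwt (insert μ s) (insert μ T) w = w μ * vwt s T w := by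
      have hsd : insert μ s \ insert μ T = s \ T := by
        ext ν
        by_cases hν : ν = μ
        · subst hν; simp [mem_sdiff, hμ]
        · simp [mem_sdiff, hν]
      unfold vwt
      rw [prod_insert hμT, hsd]
      ring
    rw [e, vtx_insert Nc hμT, ← add_assoc]; push_cast; ring

/-- **CONVEXITY**: for weights in `[0,1]` on `s`, `|icore s u z w|² ≤ Σ_{T⊆s} vwt s T w · |u(z + vtx T)|²`. [folklore] -/
theorem norm_icore_sq_le {s : Finset (Fin d)} {w : Fin d → ℝ} (h0 : ∀ ν ∈ s, 0 ≤ w ν) (h1 : ∀ ν ∈ s, w ν ≤ 1) (u : Tor Nc → ℂ) (z : Tor Nc) :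
    ‖icore Nc s u z w‖ ^ 2 ≤ ∑ T ∈ s.powerset, vwt s T w * ‖u (z + vtx Nc T)‖ ^ 2 := by
  have hw : ∀ T ∈ s.powerset, 0 ≤ vwt s T w := fun T hT => vwt_nonneg h0 h1 (mem_powerset.mp hT)
  -- `|Σ a_T b_T| ≤ Σ a_T |b_T| = Σ √a_T · (√a_T |b_T|)`
  have h2 : ‖icore Nc s u z w‖ ≤ ∑ T ∈ s.powerset, Real.sqrt (vwt s T w) * (Real.sqrt (vwt s T w) * ‖u (z + vtx Nc T)‖) := by
    refine (norm_sum_le _ _).trans (le_of_eq (sum_congr rfl fun T hT => ?_))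
    rw [norm_mul, Complex.norm_real, Real.norm_of_nonneg (hw T hT), ← mul_assoc, Real.mul_self_sqrt (hw T hT)]
  have h3 := Finset.sum_mul_sq_le_sq_mul_sq s.powerset (fun T => Real.sqrt (vwt s T w)) (fun T => Real.sqrt (vwt s T w) * ‖u (z + vtx Nc T)‖)
  have h4 : ∑ T ∈ s.powerset, Real.sqrt (vwt s T w) ^ 2 = 1 := by
    rw [← sum_vwt s w]; exact sum_congr rfl fun T hT => Real.sq_sqrt (hw T hT)
  have h5 : ∑ T ∈ s.powerset, (Real.sqrt (vwt s T w) * ‖u (z + vtx Nc T)‖) ^ 2 = ∑ T ∈ s.powerset, vwt s T w * ‖u (z + vtx Nc T)‖ ^ 2 :=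
    sum_congr rfl fun T hT => by rw [mul_pow, Real.sq_sqrt (hw T hT)]
  rw [h4, one_mul, h5] at h3
  have h0' : 0 ≤ ∑ T ∈ s.powerset, Real.sqrt (vwt s T w) * (Real.sqrt (vwt s T w) * ‖u (z + vtx Nc T)‖) :=
    sum_nonneg fun T hT => mul_nonneg (Real.sqrt_nonneg _) (mul_nonneg (Real.sqrt_nonneg _) (norm_nonneg _))
  calc ‖icore Nc s u z w‖ ^ 2 ≤ (∑ T ∈ s.powerset, Real.sqrt (vwt s T w) * (Real.sqrt (vwt s T w) * ‖u (z + vtx Nc T)‖)) ^ 2 :=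
        pow_le_pow_left₀ (norm_nonneg _) h2 2
    _ ≤ ∑ T ∈ s.powerset, vwt s T w * ‖u (z + vtx Nc T)‖ ^ 2 := h3

end Core

/-! ## §2 The multilinear prolongation on the two-level tori and its step formula -/

section Torus

variable (N R : ℕ) [NeZero N] [NeZero R] (M : Fin d → ℕ) [hM : ∀ μ, NeZero (M μ)]

/-- the in-cell weights `twR x ν = rem(x)_ν / R ∈ [0, 1)` (real form of `CellTaylorPlanting.tw`). [folklore] -/
def twR (x : Tor (fine (R * N) M)) : Fin d → ℝ := fun ν => ((rem N R M x ν : ℕ) : ℝ) / R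

omit [NeZero N] hM in
/-- `0 ≤ twR x ν`. [folklore] -/
theorem twR_nonneg (x : Tor (fine (R * N) M)) (ν : Fin d) : 0 ≤ twR N R M x ν := by
  unfold twR; positivity

omit [NeZero N] hM in
/-- `twR x ν ≤ 1`. [folklore] -/
theorem twR_le_one (x : Tor (fine (R * N) M)) (ν : Fin d) : twR N R M x ν ≤ 1 := by
  have hR : (0 : ℝ) < R := Nat.cast_pos.mpr (Nat.pos_of_ne_zero (NeZero.ne R))
  unfold twR
  rw [div_le_one hR]
  exact_mod_cast (rem N R M x ν).isLt.le

omit [NeZero N] hM in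
/-- the other weights are untouched by a step in direction `μ`. [folklore] -/
theorem twR_add_unitVec_of_ne {μ ν : Fin d} (h : ν ≠ μ) (x : Tor (fine (R * N) M)) :
    twR N R M (x + unitVec (fine (R * N) M) μ) ν = twR N R M x ν := by
  unfold twR; rw [rem_add_unitVec_of_ne N R M h x]

/-- on the far `μ`-face: own weight `(R−1)/R`, and `0` after the step. [folklore] -/
theorem twR_face {μ : Fin d} {x : Tor (fine (R * N) M)} (hf : R ∣ (x μ).val + 1) :
    twR N R M x μ = ((R : ℝ) - 1) / R ∧ twR N R M (x + unitVec (fine (R * N) M) μ) μ = 0 := by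
  have hR : 1 ≤ R := Nat.pos_of_ne_zero (NeZero.ne R)
  unfold twR
  rw [val_rem_of_face N R M hf, val_rem_add_unitVec_of_face N R M hf, Nat.cast_sub hR]
  simp

/-- inside the cell: the own weight rises by `1/R`. [folklore] -/
theorem twR_not_face {μ : Fin d} {x : Tor (fine (R * N) M)} (hf : ¬ R ∣ (x μ).val + 1) :
    twR N R M (x + unitVec (fine (R * N) M) μ) μ = twR N R M x μ + 1 / R := by
  unfold twR
  rw [val_rem_add_unitVec_of_not_face N R M hf]
  push_cast
  ring

/-- **THE MULTILINEAR PROLONGATION** `Pml u x = Σ_{T} (Π_{ν∈T} tw_ν(x))(Π_{ν∉T}(1 − tw_ν(x)))·u(par x + vtx T)` — the coarse field `u`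
interpolated multilinearly inside every cell of the `R`-times finer torus. [folklore] -/
def Pml (u : Tor (fine N M) → ℂ) (x : Tor (fine (R * N) M)) : ℂ := icore (fine N M) univ u (par N R M x) (twR N R M x)

omit [NeZero N] hM in
/-- splitting off the direction `μ`: `Pml u x = (1 − tw_μ)·I_μ(par x) + tw_μ·I_μ(par x + e_μ)`, `I_μ = icore (univ ∖ {μ}) u · (twR x)`. [folklore] -/
theorem Pml_eq_split (μ : Fin d) (u : Tor (fine N M) → ℂ) (x : Tor (fine (R * N) M)) :
    Pml N R M u x = ((1 - twR N R M x μ : ℝ) : ℂ) * icore (fine N M) (univ.erase μ) u (par N R M x) (twR N R M x)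
      + (twR N R M x μ : ℂ) * icore (fine N M) (univ.erase μ) u (par N R M x + unitVec (fine N M) μ) (twR N R M x) := by
  have hu : (univ : Finset (Fin d)) = insert μ (univ.erase μ) := (insert_erase (mem_univ μ)).symm
  rw [Pml]
  conv_lhs => rw [hu]
  rw [icore_insert (fine N M) (notMem_erase μ univ)]

/-- **THE STEP FORMULA**: `Pml u (x + e′_μ) − Pml u x = R⁻¹ · icore (univ ∖ {μ}) (∇_μ u) (par x) (twR x)` — one formula for the in-cell steps
(`par` unchanged, own weight `+1/R`) and for the cell-crossing step (`par + e_μ`, own weight `(R−1)/R ↦ 0`). [folklore] -/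
theorem Pml_step (μ : Fin d) (u : Tor (fine N M) → ℂ) (x : Tor (fine (R * N) M)) :
    Pml N R M u (x + unitVec (fine (R * N) M) μ) - Pml N R M u x
      = ((1 / R : ℝ) : ℂ) * icore (fine N M) (univ.erase μ) (fun y => u (y + unitVec (fine N M) μ) - u y) (par N R M x) (twR N R M x) := by
  set s := univ.erase μ with hs
  set z := par N R M x with hz
  set e := unitVec (fine N M) μ with he
  -- weights on `s` agree before and after the step
  have hw : ∀ ν ∈ s, twR N R M (x + unitVec (fine (R * N) M) μ) ν = twR N R M x ν :=
    fun ν hν => twR_add_unitVec_of_ne N R M (ne_of_mem_erase hν) x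
  have hI : ∀ z', icore (fine N M) s u z' (twR N R M (x + unitVec (fine (R * N) M) μ)) = icore (fine N M) s u z' (twR N R M x) :=
    fun z' => icore_congr_w (fine N M) s u z' hw
  -- the difference of the two transversal interpolants is the interpolant of the coarse difference
  have hdiff : icore (fine N M) s u (z + e) (twR N R M x) - icore (fine N M) s u z (twR N R M x)
      = icore (fine N M) s (fun y => u (y + e) - u y) z (twR N R M x) := by
    rw [icore_shift, ← icore_sub]
  rw [Pml_eq_split N R M μ u (x + unitVec (fine (R * N) M) μ), Pml_eq_split N R M μ u x, hI, hI, par_add_unitVec]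
  by_cases hf : R ∣ (x μ).val + 1
  · -- cell-crossing step
    obtain ⟨h1, h2⟩ := twR_face N R M hf
    rw [if_pos hf, h1, h2, ← hz, ← he, ← hs, ← hdiff]
    have hR : (R : ℂ) ≠ 0 := by exact_mod_cast NeZero.ne R
    push_cast
    field_simp
    ring
  · -- in-cell step
    rw [if_neg hf, twR_not_face N R M hf, ← hz, ← he, ← hs, ← hdiff]
    push_cast
    ring

/-! ## §3 The energy inequality -/

/-- translation invariance of a torus sum. [folklore] -/
theorem sum_shift_eq (F : Tor (fine N M) → ℝ) (e : Tor (fine N M)) : ∑ y, F (y + e) = ∑ y, F y :=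
  Fintype.sum_equiv (Equiv.addRight e) (fun y => F (y + e)) F fun _ => rfl

/-- the weights of a tiled site: `twR (cpt y + off j) = j/R`. [folklore] -/
theorem twR_tile (y : Tor (fine N M)) (j : Fin d → Fin R) : twR N R M (cpt N R M y + off N R M j) = fun ν => ((j ν : ℕ) : ℝ) / R := by
  funext ν; unfold twR; rw [rem_cpt_add_off]

/-- **THE ENERGY INEQUALITY, one direction**: `Σ_{x′} |Pml u (x′+e′_μ) − Pml u x′|² ≤ (R^d/R²)·Σ_x |u(x+e_μ) − u x|²`.
Convexity in each cell, the tile decomposition `x′ = cpt y + off j`, translation invariance of `Σ_y`, and `Σ_T vwt = 1` (so the sum over the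
offsets `j` contributes exactly `R^d`). [folklore] -/
theorem sum_norm_sq_Pml_step_le (μ : Fin d) (u : Tor (fine N M) → ℂ) :
    ∑ x : Tor (fine (R * N) M), ‖Pml N R M u (x + unitVec (fine (R * N) M) μ) - Pml N R M u x‖ ^ 2
      ≤ (R : ℝ) ^ d / (R : ℝ) ^ 2 * ∑ y : Tor (fine N M), ‖u (y + unitVec (fine N M) μ) - u y‖ ^ 2 := by
  set s := univ.erase μ with hs
  set g : Tor (fine N M) → ℂ := fun y => u (y + unitVec (fine N M) μ) - u y with hg
  set G : ℝ := ∑ y : Tor (fine N M), ‖g y‖ ^ 2 with hG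
  have hR : (0 : ℝ) < R := Nat.cast_pos.mpr (Nat.pos_of_ne_zero (NeZero.ne R))
  -- pointwise: step formula + convexity
  have hpt : ∀ x : Tor (fine (R * N) M), ‖Pml N R M u (x + unitVec (fine (R * N) M) μ) - Pml N R M u x‖ ^ 2
      ≤ (1 / R) ^ 2 * ∑ T ∈ s.powerset, vwt s T (twR N R M x) * ‖g (par N R M x + vtx (fine N M) T)‖ ^ 2 := by
    intro x
    rw [Pml_step, norm_mul, mul_pow, Complex.norm_real, Real.norm_of_nonneg (by positivity)]
    exact mul_le_mul_of_nonneg_left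
      (norm_icore_sq_le (fine N M) (fun ν _ => twR_nonneg N R M x ν) (fun ν _ => twR_le_one N R M x ν) g (par N R M x)) (by positivity)
  -- the tiled sum of the majorant is `R^d · G`
  have htile : ∑ x : Tor (fine (R * N) M), ∑ T ∈ s.powerset, vwt s T (twR N R M x) * ‖g (par N R M x + vtx (fine N M) T)‖ ^ 2
      = (R : ℝ) ^ d * G := by
    rw [sum_fine_eq_sum_tile_real N R M]
    simp_rw [par_cpt_add_off, twR_tile]
    -- Σ_y Σ_j Σ_T w_T(j) |g(y + vtx T)|² = Σ_j Σ_T w_T(j) · Σ_y |g(y + vtx T)|² = Σ_j Σ_T w_T(j) · G = Σ_j G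
    rw [sum_comm]
    have hinner : ∀ j : Fin d → Fin R, ∑ y : Tor (fine N M), ∑ T ∈ s.powerset,
        vwt s T (fun ν => ((j ν : ℕ) : ℝ) / R) * ‖g (y + vtx (fine N M) T)‖ ^ 2 = G := by
      intro j
      rw [sum_comm]
      calc ∑ T ∈ s.powerset, ∑ y : Tor (fine N M), vwt s T (fun ν => ((j ν : ℕ) : ℝ) / R) * ‖g (y + vtx (fine N M) T)‖ ^ 2
          = ∑ T ∈ s.powerset, vwt s T (fun ν => ((j ν : ℕ) : ℝ) / R) * G := by
            refine sum_congr rfl fun T _ => ?_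
            rw [← mul_sum, show ∑ i : Tor (fine N M), ‖g (i + vtx (fine N M) T)‖ ^ 2 = G from sum_shift_eq N M (fun y => ‖g y‖ ^ 2) _]
        _ = G := by rw [← sum_mul, sum_vwt, one_mul]
    simp_rw [hinner]
    rw [sum_const, card_univ, Fintype.card_fun, Fintype.card_fin, Fintype.card_fin, nsmul_eq_mul]
    push_cast
    ring
  calc ∑ x : Tor (fine (R * N) M), ‖Pml N R M u (x + unitVec (fine (R * N) M) μ) - Pml N R M u x‖ ^ 2
      ≤ ∑ x : Tor (fine (R * N) M), (1 / R) ^ 2 * ∑ T ∈ s.powerset, vwt s T (twR N R M x) * ‖g (par N R M x + vtx (fine N M) T)‖ ^ 2 :=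
        sum_le_sum fun x _ => hpt x
    _ = (1 / R) ^ 2 * ((R : ℝ) ^ d * G) := by rw [← mul_sum, htile]
    _ = (R : ℝ) ^ d / (R : ℝ) ^ 2 * G := by field_simp

/-- **THE ENERGY INEQUALITY** (all directions): `Σ_μ Σ_{x′} |∇′_μ Pml u|² ≤ (R^d/R²)·Σ_μ Σ_x |∇_μ u|²` — with the Wilson normalisation
`S_η(u) = ½η^{d−2}Σ_μΣ_x|∇_μu|²` on the `η`-lattice this reads `S_{η/R}(Pml u) ≤ S_η(u)`: the multilinear prolongation does NOT raise the energy
(hypothesis (PROL) of `GAN24/MonotoneSqueeze`, scalar prototype). [folklore] -/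
theorem energy_Pml_le (u : Tor (fine N M) → ℂ) :
    ∑ μ : Fin d, ∑ x : Tor (fine (R * N) M), ‖Pml N R M u (x + unitVec (fine (R * N) M) μ) - Pml N R M u x‖ ^ 2
      ≤ (R : ℝ) ^ d / (R : ℝ) ^ 2 * ∑ μ : Fin d, ∑ y : Tor (fine N M), ‖u (y + unitVec (fine N M) μ) - u y‖ ^ 2 := by
  rw [mul_sum]
  exact sum_le_sum fun μ _ => sum_norm_sq_Pml_step_le N R M μ u

omit [NeZero N] hM in
/-- **CONSTANTS ARE REPRODUCED**: `Pml c = c` (the weights sum to one). [folklore] -/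
theorem Pml_const (c : ℂ) (x : Tor (fine (R * N) M)) : Pml N R M (fun _ => c) x = c := by
  rw [Pml, icore, ← sum_mul]
  have h := sum_vwt (univ : Finset (Fin d)) (twR N R M x)
  have h' : ∑ T ∈ (univ : Finset (Fin d)).powerset, (vwt univ T (twR N R M x) : ℂ) = 1 := by exact_mod_cast h
  rw [h', one_mul]

/-- **VALUES AT THE CELL CORNERS**: at a corner site (`rem = 0`) the prolongation returns the coarse value, `Pml u (cpt y) = u y`. [folklore] -/
theorem Pml_corner (u : Tor (fine N M) → ℂ) (y : Tor (fine N M)) : Pml N R M u (cpt N R M y + off N R M (fun _ => 0)) = u y := by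
  rw [Pml, par_cpt_add_off, twR_tile, icore]
  have hw : ∀ T ∈ (univ : Finset (Fin d)).powerset, T ≠ ∅ → (vwt univ T (fun ν => (((0 : Fin R) : ℕ) : ℝ) / R) : ℂ) * u (y + vtx (fine N M) T) = 0 := by
    intro T _ hT
    obtain ⟨ν, hν⟩ := nonempty_iff_ne_empty.mpr hT
    have : vwt univ T (fun ν => (((0 : Fin R) : ℕ) : ℝ) / R) = 0 := by
      unfold vwt
      rw [prod_eq_zero hν (by simp), zero_mul]
    rw [this]; push_cast; ring
  rw [sum_eq_single_of_mem ∅ (empty_mem_powerset _) (fun T hT hne => hw T hT hne)]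
  simp [vwt, vtx]

end Torus

end Summit.QuantumFields.BalabanUV.Beta.GAN24.MultilinearProlongation
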